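import Literature.MathematicalPhysics.QuantumFieldTheory.Balaban1983to89.B9Eq324PenaltyKernelForm
import Literature.MathematicalPhysics.QuantumFieldTheory.Balaban1983to89.B9Eq384RemainderLetters
import Literature.MathematicalPhysics.QuantumFieldTheory.Balaban1983to89.B9Eq319QprimeLipschitz

/-!
# `Balaban1983to89.B9Eq358TowerKernelSizes` — T. Bałaban, *Propagators for lattice gauge theories in a background field*, Commun. Math. Phys. **99** (1985) 389–434
# [Balaban1985BackgroundPropagators] (3.58)–(3.59) p. 402 («|F′_{2,j}(A; y, x)| ≦ O(1)α₁», «We have a similar expansion for the adjoint operator») with (3.35)–(3.37) p. 396 and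
# (3.19) p. 393: **THE SIZES OF THE SECT. B PROGRAMME's (3.59) DATA `kF`, `sF` AT THE NE9 CHAIN's COMPOSITE AVERAGING, FROM THE CHAIN's CLASS** — with the level backgrounds
# `Ū^j` in `U1`, `‖Ū^j(b) − 1‖ ≤ ε_j ≤ ε⋆r^j` (print's running windows read at the composed depths, `0 ≤ r < 1`): `‖(k_Q(U) − k_Q(1))(y, x)‖ ≤ (e^{3d(L−1)ε⋆∕(1−r)} − 1)·L^{−kd}`,
# `‖s_Q(U)(x) − s_Q(1)(x)‖ ≤ M_φM_φ′(c₁∕c₀)(e^{2M_φM_φ′d(L−1)ε⋆∕(1−r)} − 1)·L^{−kd}`, INDEPENDENT OF THE NUMBER OF LEVELS, and `e^{cε} − 1 ≤ (ce^{cε₀})·ε` — r06's `hkF`∕`hsF`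
# (`‖kF y x‖ ≤ C_qα₁w(y)`, `‖sF x‖ ≤ C_qα₁`) for `B9Thm34SectBUniform(R1).thm34_Gp_uniform` at the chain, with `C_q` BEFORE the lattice; junction item (j3-b)∕(j9) of the NE9
# lineage's route memo `ROUTE-J-VIA-THM34-g98.md`

statement-level skeleton of published theorems with citation tags; proofs where landed; nothing here is a claim about the Yang–Mills mass gap

CITATION HEADER (lean-in-tree rule).  Audit cell `pub-balaban`, sub-cell `t4`, BINDER row NE9; NE9 crux-team LEAF PROVER 01 (`b2b-balaban-t4-ne9-formalise-leaf-01`,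
gen 99; bears_on: R4/N22).  Vocabulary BY NAME: this lineage's `B9Eq357QprimeTowerKernelForm` (`kQ`, `norm_kF_le`, `norm_kQ_le`) and `B9Eq324PenaltyKernelForm` (`sQ`,
`norm_sQ_sub_sQ_one_le`, `sQ_one_apply`), the chain's `B9Eq384RemainderLetters.norm_adTransportW_sub_le` (`‖R_W(V)(b)w − w‖ ≤ 2M_φM_φ′ε‖w‖`),
`B9Eq319QprimeLipschitz.norm_adTransport_sub_le` (`‖R(V(b))X − X‖ ≤ ε(2+ε)‖X‖`), `B7Prop1Explicit.U1` ∕ `norm_inv_sub_one_le`, `B9Eq315QTowerFlat.UlevOf_one`,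
`B9Eq33CovDerivVector.adTransport_one`; the geometric-window bookkeeping is that of ne9-leaf-02's `B9Eq315QTowerLipschitzProfile` §4 (`Π(1+t_j) ≤ e^{Σt_j}`, `Σ ε⋆r^j ≤ ε⋆∕(1−r)`),
re-proved here in three private lines.  Sources read through those files' verbatim quotations: [Balaban1985BackgroundPropagators] p. 402 (3.58)–(3.59), p. 396 (3.35)–(3.37), p. 393 (3.19),
p. 403 «the averaging operations depend analytically on U».  [folklore] bookkeeping; NOTHING of print's proofs is reproduced.

WHAT IS PROVED (sorry-free; proof lane — no `def`).
* §1 (private `exp_sub_one_le_mul`: `e^x − 1 ≤ xe^x`), `prod_pow_sub_one_le` (`Π_{j<N}(1 + t_j)^p − 1 ≤ e^{p·s∕(1−r)} − 1` for `0 ≤ t_j ≤ sr^j`).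
* §2 `kQ_flatLevels_eq` (the kernel at the flat level backgrounds `Ū^j(1) = 1` IS the flat kernel `k_Q(1)`), **`norm_kF_le_of_class`** (r06's `hkF` with
  `C_qα₁ := e^{3d(L−1)ε⋆∕(1−r)} − 1`, `w ≡ L^{−kd}`), **`norm_sF_le_of_class`** (r06's `hsF` with `C_qα₁ := M_φM_φ′(c₁∕c₀)L^{−kd}(e^{2M_φM_φ′d(L−1)ε⋆∕(1−r)} − 1)`, `= M_φM_φ′(…)` on the
  diagonal `c₀L^{kd} = c₁`), `exp_window_sub_one_le` (the `O(1)α₁` form: `e^{cε} − 1 ≤ (ce^{cε₀})ε` for `0 ≤ ε ≤ ε₀`, `0 ≤ c`).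
HONEST SCOPE.  Bookkeeping; the sizes are those of the chain's own Lipschitz letters under the displayed geometric window (NOT print's (3.58) via its contour expansion
`B9Eq357Levels`∕`B9Eq358KeyEstimate`, a different carrier); constants crude; NE9 NOT PRINTED ∕ NOT PROVED; spine PROVED 0∕9; rung (B)+1 finite T⁴ — NOT infinite volume, NOT mass gap,
NOT BetaPertH, NOT Clay.  HONEST DEPENDENCY: continuum YM on T⁴ ⇐ BetaPertH ∧ nine spine estimates (0/9 proved); BetaPertH ⇐ (D1) ∧ (D4) ∧ CAP+tail; G-an2-4 gates asym, D1 and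
NE2/3/4.  NEW file; nothing modified.  Net new unproved facts: 0.
-/

noncomputable section

open scoped BigOperators

namespace Literature.MathematicalPhysics.QuantumFieldTheory.Balaban1983to89.B9Eq358TowerKernelSizes

open B4Sect5Torus (TSite)
open B7Prop1Explicit (U1 norm_inv_sub_one_le mem_U1)
open B9SectCLatticeCarrier (Bond shift)
open B9Eq319QprimeTorus (fineP blockCoord)
open B9Eq315QTower (towerP UlevOf)
open B9Eq310HessianOperator (adTransportW)
open B9Eq33CovDerivVector (adTransport adTransport_one)
open B9Eq357QprimeTowerKernelForm (blkK kQ norm_kF_le norm_kQ_le)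
open B9Eq324PenaltyKernelForm (sQ norm_sQ_sub_sQ_one_le sQ_one_apply)
open B9Eq384RemainderLetters (norm_adTransportW_sub_le)
open B9Eq319QprimeLipschitz (norm_adTransport_sub_le)

/-! ## §1 Elementary: the geometric-window product -/

section Elementary

/-- `e^x − 1 ≤ x·e^x` for `x ≥ 0`. [folklore] -/
private theorem exp_sub_one_le_mul (x : ℝ) : Real.exp x - 1 ≤ x * Real.exp x := by
  have h := Real.add_one_le_exp (-x)
  have hpos := Real.exp_pos x
  have h2 : (-x + 1) * Real.exp x ≤ Real.exp (-x) * Real.exp x := mul_le_mul_of_nonneg_right h hpos.le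
  rw [← Real.exp_add, neg_add_cancel, Real.exp_zero] at h2
  nlinarith

/-- **`e^{cε} − 1 ≤ (c·e^{cε₀})·ε`** for `0 ≤ ε ≤ ε₀`, `0 ≤ c` — the `O(1)α₁` form of a geometric-window product. [folklore] [cite: Balaban1985BackgroundPropagators, (3.58) p.402] -/
theorem exp_window_sub_one_le {c ε ε₀ : ℝ} (hc : 0 ≤ c) (hε : 0 ≤ ε) (hεε : ε ≤ ε₀) : Real.exp (c * ε) - 1 ≤ (c * Real.exp (c * ε₀)) * ε := by
  have h1 := exp_sub_one_le_mul (c * ε)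
  have h2 : Real.exp (c * ε) ≤ Real.exp (c * ε₀) := Real.exp_le_exp.mpr (mul_le_mul_of_nonneg_left hεε hc)
  calc Real.exp (c * ε) - 1 ≤ c * ε * Real.exp (c * ε) := h1
    _ ≤ c * ε * Real.exp (c * ε₀) := mul_le_mul_of_nonneg_left h2 (mul_nonneg hc hε)
    _ = (c * Real.exp (c * ε₀)) * ε := by ring

/-- **`Π_{j<N}(1 + t_j)^p − 1 ≤ e^{p·s∕(1−r)} − 1`** for `0 ≤ t_j ≤ s·r^j` (`j < N`), `0 ≤ r < 1`, `0 ≤ s` — independent of `N`. [folklore]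
[cite: Balaban1985BackgroundPropagators, (3.35)–(3.37) p.396, (3.58) p.402] -/
theorem prod_pow_sub_one_le (t : ℕ → ℝ) (p N : ℕ) {s r : ℝ} (ht : ∀ j, 0 ≤ t j) (hts : ∀ j < N, t j ≤ s * r ^ j) (hs : 0 ≤ s) (hr0 : 0 ≤ r) (hr1 : r < 1) :
    (∏ j ∈ Finset.range N, (1 + t j) ^ p) - 1 ≤ Real.exp (p * (s / (1 - r))) - 1 := by
  have hP : ∏ j ∈ Finset.range N, (1 + t j) ≤ Real.exp (s / (1 - r)) := by
    calc ∏ j ∈ Finset.range N, (1 + t j) ≤ ∏ j ∈ Finset.range N, Real.exp (t j) :=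
          Finset.prod_le_prod (fun j _ => by linarith [ht j]) fun j _ => by linarith [Real.add_one_le_exp (t j)]
      _ = Real.exp (∑ j ∈ Finset.range N, t j) := (Real.exp_sum _ _).symm
      _ ≤ Real.exp (s / (1 - r)) := by
          refine Real.exp_le_exp.mpr ?_
          calc ∑ j ∈ Finset.range N, t j ≤ ∑ j ∈ Finset.range N, s * r ^ j := Finset.sum_le_sum fun j hj => hts j (Finset.mem_range.1 hj)
            _ = s * ∑ j ∈ Finset.range N, r ^ j := (Finset.mul_sum _ _ _).symm
            _ ≤ s * (1 - r)⁻¹ := by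
                refine mul_le_mul_of_nonneg_left ?_ hs
                have h := geom_sum_Ico_le_of_lt_one (m := 0) (n := N) hr0 hr1
                rw [pow_zero, ← Finset.range_eq_Ico, one_div] at h
                exact h
            _ = s / (1 - r) := (div_eq_mul_inv _ _).symm
  rw [Finset.prod_pow, Real.exp_nat_mul]
  have h0 : 0 ≤ ∏ j ∈ Finset.range N, (1 + t j) := Finset.prod_nonneg fun j _ => by linarith [ht j]
  linarith [pow_le_pow_left₀ h0 hP p]

end Elementary

/-! ## §2 The (3.59) sizes at the chain from the class -/

section Sizes

variable {d : ℕ} (L : ℕ) [NeZero L] (m : Fin d → ℕ) [∀ i, NeZero (m i)] (n : ℕ)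
  {𝔸 : Type*} [NormedRing 𝔸] [NormedAlgebra ℂ 𝔸] [CompleteSpace 𝔸] [NormOneClass 𝔸] [FiniteDimensional ℂ 𝔸]
  {W : Type*} [NormedAddCommGroup W] [InnerProductSpace ℂ W] [FiniteDimensional ℂ W] (φ : W ≃ₗ[ℂ] 𝔸)
  {c₀ : ℝ} [Fact (0 < c₀)] {c₁ : ℝ} [Fact (0 < c₁)] (U : Bond d (towerP L m (n + 1)) → 𝔸ˣ)
  (εU : ℕ → ℝ) (hεU : ∀ j, 0 ≤ εU j) (hεU1 : ∀ j, εU j ≤ 1)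
  (hLε : ∀ (j : ℕ) (bd : Bond d (towerP L m (j + 1))), ‖(UlevOf L m (n + 1) U j bd : 𝔸) - 1‖ ≤ εU j)
  (hLb : ∀ (j : ℕ) (bd : Bond d (towerP L m (j + 1))), UlevOf L m (n + 1) U j bd ∈ U1 𝔸)
  {r εs : ℝ} (hr0 : 0 ≤ r) (hr1 : r < 1) (hεs : 0 ≤ εs) (hεg : ∀ j < n + 1, εU j ≤ εs * r ^ j)

omit [NormOneClass 𝔸] [Fact (0 < c₀)] [Fact (0 < c₁)] [FiniteDimensional ℂ W] in
/-- The kernel at the flat LEVEL backgrounds `Ū^j(1) ≡ 1` IS the flat kernel `k_Q(1)` of `B9Eq357QprimeTowerKernelForm` (`UlevOf_one`, `adTransport_one`).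
[cite: Balaban1985BackgroundPropagators, (3.19) p.393] -/
theorem kQ_flatLevels_eq :
    kQ L m n (fun j => adTransport (𝕜 := ℂ) (UlevOf L m (n + 1) (fun _ : Bond d (towerP L m (n + 1)) => (1 : 𝔸ˣ)) j)) =
      kQ L m n (fun _ _ => (LinearMap.id : 𝔸 →ₗ[ℂ] 𝔸)) := by
  have h : (fun j => adTransport (𝕜 := ℂ) (UlevOf L m (n + 1) (fun _ : Bond d (towerP L m (n + 1)) => (1 : 𝔸ˣ)) j)) =
      fun _ _ => (LinearMap.id : 𝔸 →ₗ[ℂ] 𝔸) := by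
    funext j bd; rw [B9Eq315QTowerFlat.UlevOf_one, adTransport_one]
  rw [h]

include hεU hεU1 hLε hLb hr0 hr1 hεs hεg in
omit [Fact (0 < c₀)] [Fact (0 < c₁)] [FiniteDimensional ℂ W] in
/-- **r06's `hkF` AT THE CHAIN FROM THE CLASS: `‖(k_Q(U) − k_Q(1))(y, x)‖ ≤ (e^{3d(L−1)ε⋆∕(1−r)} − 1)·(L^{n+1})^{−d}`** for every `y, x` — the transporters `R(Ū^j(b))` of `𝔸` are
`3ε_j`-close to the identity (`ε_j(2 + ε_j) ≤ 3ε_j` for `ε_j ≤ 1`), then `norm_kF_le` and the geometric window. [cite: Balaban1985BackgroundPropagators, (3.58) p.402, (3.19) p.393, (3.35) p.396] -/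
theorem norm_kF_le_of_class (y : TSite d m) (x : TSite d (towerP L m (n + 1))) :
    ‖(kQ L m n (fun j => adTransport (𝕜 := ℂ) (UlevOf L m (n + 1) U j)) - kQ L m n (fun _ _ => (LinearMap.id : 𝔸 →ₗ[ℂ] 𝔸))) y x‖ ≤
      (Real.exp (((d * (L - 1) : ℕ) : ℝ) * (3 * εs / (1 - r))) - 1) * (((L : ℝ) ^ (n + 1)) ^ d)⁻¹ := by
  have hR : ∀ j < n + 1, ∀ (z : TSite d (towerP L m (j + 1))) (μ : Fin d),
      blockCoord L (towerP L m j) z = blockCoord L (towerP L m j) (shift μ z) → (∀ i, (z i : ℕ) / L ^ (j + 1) = (y i : ℕ)) →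
        ∀ v : 𝔸, ‖adTransport (𝕜 := ℂ) (UlevOf L m (n + 1) U j) (z, μ) v - v‖ ≤ (3 * εU j) * ‖v‖ := by
    intro j _ z μ _ _ v
    have h := norm_adTransport_sub_le L (towerP L m j) (UlevOf L m (n + 1) U j) (εU := εU j) (fun bd => hLε j bd)
      (fun bd => (norm_inv_sub_one_le (hLb j bd)).trans (hLε j bd)) (z, μ) v
    refine h.trans (mul_le_mul_of_nonneg_right ?_ (norm_nonneg _))
    nlinarith [hεU j, hεU1 j]
  have h1 := norm_kF_le L m n (fun j => adTransport (𝕜 := ℂ) (UlevOf L m (n + 1) U j)) (fun j => 3 * εU j) (fun j => by linarith [hεU j]) y hR x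
  refine h1.trans (mul_le_mul_of_nonneg_right ?_ (by positivity))
  have h2 := prod_pow_sub_one_le (fun j => 3 * εU j) (d * (L - 1)) (n + 1) (s := 3 * εs) (r := r) (fun j => by linarith [hεU j])
    (fun j hj => by have := hεg j hj; linarith) (by linarith) hr0 hr1
  exact h2.trans le_rfl

variable {Mφ Mφ' : ℝ} (hMφ : 0 ≤ Mφ) (hMφ' : 0 ≤ Mφ') (hφ : ∀ w, ‖φ w‖ ≤ Mφ * ‖w‖) (hφ' : ∀ X, ‖φ.symm X‖ ≤ Mφ' * ‖X‖)

include hMφ hMφ' hφ hφ' hεU hLε hLb hr0 hr1 hεs hεg in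
/-- **r06's `hsF` AT THE CHAIN FROM THE CLASS: `‖s_Q(U)(x) − s_Q(1)(x)‖ ≤ M_φM_φ′(c₁∕c₀)(e^{2M_φM_φ′d(L−1)ε⋆∕(1−r)} − 1)·(L^{n+1})^{−d}`** — the fibre transporters `R_W(Ū^j(b))` are
`2M_φM_φ′ε_j`-close to the identity (`norm_adTransportW_sub_le`), then `norm_sQ_sub_sQ_one_le` and the geometric window; `(c₁∕c₀)(L^{n+1})^{−d} = 1` on the diagonal.
[cite: Balaban1985BackgroundPropagators, (3.59) p.402, (3.24) p.394, (3.35) p.396] -/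
theorem norm_sF_le_of_class (x : TSite d (towerP L m (n + 1))) :
    ‖sQ L m n φ U (c₀ := c₀) (c₁ := c₁) x - sQ L m n φ (fun _ : Bond d (towerP L m (n + 1)) => (1 : 𝔸ˣ)) (c₀ := c₀) (c₁ := c₁) x‖ ≤
      Mφ * Mφ' * ((c₁ / c₀) * ((Real.exp (((d * (L - 1) : ℕ) : ℝ) * (2 * Mφ * Mφ' * εs / (1 - r))) - 1) * (((L : ℝ) ^ (n + 1)) ^ d)⁻¹)) := by
  have hc₀ : 0 < c₀ := Fact.out
  have hc₁ : 0 < c₁ := Fact.out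
  have hR : ∀ j < n + 1, ∀ (z : TSite d (towerP L m (j + 1))) (μ : Fin d),
      blockCoord L (towerP L m j) z = blockCoord L (towerP L m j) (shift μ z) → (∀ i, (z i : ℕ) / L ^ (j + 1) = ((blkK L m n x) i : ℕ)) →
        ∀ w : W, ‖adTransportW φ (UlevOf L m (n + 1) U j) (z, μ) w - w‖ ≤ (2 * Mφ * Mφ' * εU j) * ‖w‖ :=
    fun j _ z μ _ _ w => norm_adTransportW_sub_le φ hφ hφ' hMφ' (UlevOf L m (n + 1) U j) (z, μ) (hLb j _) (hLε j _) w
  have h1 := norm_sQ_sub_sQ_one_le L m n φ U (c₀ := c₀) (c₁ := c₁) hMφ hMφ' hφ hφ' (fun j => 2 * Mφ * Mφ' * εU j)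
    (fun j => by have := hεU j; positivity) x hR
  refine h1.trans ?_
  have h2 := prod_pow_sub_one_le (fun j => 2 * Mφ * Mφ' * εU j) (d * (L - 1)) (n + 1) (s := 2 * Mφ * Mφ' * εs) (r := r)
    (fun j => by have := hεU j; positivity) (fun j hj => by
      have := mul_le_mul_of_nonneg_left (hεg j hj) (by positivity : (0 : ℝ) ≤ 2 * Mφ * Mφ'); linarith) (by positivity) hr0 hr1
  have h3 : Real.exp (((d * (L - 1) : ℕ) : ℝ) * (2 * Mφ * Mφ' * εs / (1 - r))) - 1 =
      Real.exp (((d * (L - 1) : ℕ) : ℝ) * ((2 * Mφ * Mφ' * εs) / (1 - r))) - 1 := rfl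
  rw [h3]
  gcongr

end Sizes

end Literature.MathematicalPhysics.QuantumFieldTheory.Balaban1983to89.B9Eq358TowerKernelSizes

end
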